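import Summits.HodgeConjecture.HodgeConjecture.Theorems.F0P3U3SquareIntegrableExponentsHolds   -- ★ N5 PROVED: `u3SquareIntegrableExponents_holds` (Casselman Thm. 4.4.6, rank one, every non-split `v`)
import Summits.HodgeConjecture.HodgeConjecture.Theorems.F0P3bCentralCharacterUnitaryNonsplit   -- ★ `isCompact_center_cmLocal_of_nonsplit`, `exists_centralChar_norm_eq_one_of_nonsplit`
import Summits.HodgeConjecture.HodgeConjecture.Theorems.F0P3cStCharTSScTracePackage            -- ★ `isAdmissible_smoothIrrep` (every smooth irrep of `U(Φ₃)(L⁺_v)` is admissible)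
import Literature.NumberTheory.Automorphic.U3PrincipalSeriesLettersUnfold                      -- ★ `U3SquareIntegrableExponents_iff` (N5 through the def-letter wall)
import Literature.NumberTheory.Automorphic.JacquetExponentsShortExact                          -- ★ p853648 (LH6-p03, row 71-(E)) `Representation.hasJacquetExponent_of_shortExact`
import Literature.NumberTheory.Automorphic.SmoothExtensionAdmissibleCentral                    -- (LH6-p04, row 71-(G)) `IsAdmissible.of_exact`, `forall_apply_eq_smul_of_exact_of_isCompact_center`
import Literature.NumberTheory.Automorphic.JacquetLineExponents                                -- ★ `HasJacquetExponent.map_of_injective`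
import Literature.NumberTheory.Automorphic.JacquetModuleExactProofs                            -- ★ `Representation.jacquetMap_injective`
import Literature.NumberTheory.Automorphic.UnitaryGroupUnipotentLimitCompactOpen               -- ★ `isLimitOfCompactOpen_cmBorelTriple_N`
import Literature.NumberTheory.Rogawski1990.U3PrincipalSeriesReducibility                     -- ★ `IrrClass.IsSquareIntegrable` (the organ's `𝔇.IsL2` currency)
import HarnessLib

/-!
# F0 · P3c · line LH6 «StCharTS» — row 71-(D) «(S1) DISCHARGED»: every smooth self-extension of a square-integrable irreducible class of `U(Φ₃)(L⁺_v)`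
# is admissible, has the same unitary central character, and is square-integrable modulo the centre (Casselman's criterion, IN HOUSE)

Cell `pub/hodgecm-mathlib`, crux H413 = `stmt-HodgeConjecture-24833` (lane `--supports … --as helper`), route HCCMUnconditional; E1 row 71 «(S1) CASSELMAN'S
CRITERION IN RANK ONE» (keeper F0P3a-p03 (g31) k18∕k20∕k28∕k38; LEAD F0P3a-plan (g16) T15-53 (B) «K2′-L² road rides iff (S1) lands as a ★ THEOREM»);
seat «LH6» LH6-p04 (g12).  THEOREMS ONLY (no definition ∕ instance ∕ notation ∕ named fact ∕ `sorry`); ★-only imports.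

WHAT.  `isSquareIntegrableModCenter_of_selfExtension` — at a NON-SPLIT finite place `v` of `L⁺` (`hns`), on `G = Gqs L v = U(Φ₃)(L⁺_v)`, for a Haar measure `μZ` on
`G ⧸ Z(G)`, a smooth irreducible `r` whose class is square-integrable (`(IrrClass.mk r).IsSquareIntegrable μZ` = the organ's `𝔇.IsL2 [r]`, ★
`U3PrincipalSeriesReducibility` :75) and ANY smooth self-extension `0 → r →i ρE →p r → 0` (binders = ★ 59-F `EPNormOneUnr` :109 `hsplit`'s prefix VERBATIM:
`E : Type`, `ρE.IsSmooth`, `i p`, `Injective i`, `ker p = range i`, `Surjective p`):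
(1) `ρE` is admissible; (2) the centre acts on `ρE` through a unitary character `ω`; (3) `ρE.IsSquareIntegrableModCenter μZ′` for EVERY Haar `μZ′` on `G ⧸ Z(G)`
(the `∀ μZ′` form asked by the (S5) pen F0P2-p06 (g23), ratified k38) — i.e. the three hypotheses of row 70 (F) `selfExtension_splits_of_memLp_matrixCoeff`
modulo ★ row 71-(d) `memLp_matrixCoeff_of_forall_isSquareIntegrableModCenter` (compact centre pull-back).

PROOF (no print letter).  (1) ★ (G2) `IsAdmissible.of_exact` (every smooth irrep of `G` is admissible, ★ `isAdmissible_smoothIrrep`).  (2) `Z(G) = E¹_v·1` is compact at a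
non-split `v` (★ `isCompact_center_cmLocal_of_nonsplit`), `r` has a unitary central character `ω` (★ `exists_centralChar_norm_eq_one_of_nonsplit`), and ★ (G3)
`forall_apply_eq_smul_of_exact_of_isCompact_center` propagates `ω` to `ρE`.  (3) CASSELMAN'S CRITERION ★ N5 `UnitaryGroup.U3SquareIntegrableExponents L` (PROVED:
★ `u3SquareIntegrableExponents_holds`) BOTH WAYS: «⇒» at the square-integrable representative `r′` of `[r]` bounds every exponent `χ′` of `r′` on `A⁻`; an exponent of
`ρE` is an exponent of `r` (sub or quotient, both `≅ r`) by ★ (E) `hasJacquetExponent_of_shortExact` (LH6-p03), hence of `r′ ≅ r` by ★ `HasJacquetExponent.map_of_injective`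
∘ ★ `jacquetMap_injective`; «⇐» at `ρE` for any Haar `μZ′`.
HONEST LABEL: count-neutral helper (`--supports`); K2′ outside the EP family = PRINT of record until the LEAD words the ride on ★ row 70 + (S5); h413 OPEN;
HC_CM is proved only modulo the 7 printed citations (2 remaining named inputs hLiu418 = `stmt-HodgeConjecture-24832`, h413 = `stmt-HodgeConjecture-24833`) until rung 0 closes.

## References
* [Casselman1995] W. Casselman, *Introduction to the theory of admissible representations of `p`-adic reductive groups* (draft 1 May 1995), Thm. 4.4.6 p. 45; §2.5 p. 28.
* [Waldspurger2003] J.-L. Waldspurger, *La formule de Plancherel pour les groupes p-adiques (d'après Harish-Chandra)*, J. Inst. Math. Jussieu 2 (2003), Prop. III.1.1 p. 263.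
* [Rogawski1990] J. D. Rogawski, *Automorphic Representations of Unitary Groups in Three Variables*, Ann. of Math. Stud. 123 (1990), §12.2 (2) p. 174; §12.6 Prop. 12.6.1 (a) p. 188.
-/

set_option autoImplicit false
-- the mandated namespace has the single-problem summit's repeated segment (`HodgeConjecture.HodgeConjecture`)
set_option linter.dupNamespace false

noncomputable section

open NumberField IsDedekindDomain MeasureTheory
open Literature.NumberTheory.Automorphic Literature.NumberTheory.Automorphic.UnitaryGroup Literature.NumberTheory.Rogawski1990
open scoped MatrixGroups

namespace Summit.HodgeConjecture.HodgeConjecture.Cruxes.H413.F0P3cStCharTSSelfExtSquareIntegrable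

variable (L : Type) [Field L] [NumberField L] [IsCMField L] (v : HeightOneSpectrum (𝓞 ↥(maximalRealSubfield L)))

set_option maxHeartbeats 4000000 in
set_option synthInstance.maxHeartbeats 400000 in
-- budget: ★ N5's statement is read at the literal CM carrier (`Gqs L v` unfolds to `↥(unitaryGroupOfForm …)` by `rfl` only; cf. ★ `U3SquareIntegrableExponents_iff` at 4·10⁶)
/-- **(S1) DISCHARGED — every smooth self-extension `ρE` of a square-integrable smooth irreducible `r` of `U(Φ₃)(L⁺_v)` (`v` non-split) is ADMISSIBLE, has the
UNITARY central character of `r`, and is SQUARE-INTEGRABLE MODULO THE CENTRE for every Haar measure on `G ⧸ Z(G)`** (Casselman's criterion ★ N5 both ways + exponent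
union along `0 → r → ρE → r → 0`; see the module docstring).  Binders after `hL2` = ★ 59-F's `hsplit` prefix verbatim.
[cite: Casselman1995, Thm. 4.4.6 p. 45; §2.5 p. 28] [cite: Waldspurger2003, Prop. III.1.1 p. 263] [cite: Rogawski1990, §12.2 (2) p. 174] -/
theorem isSquareIntegrableModCenter_of_selfExtension (hns : ∀ w : PlacesOver L v, IsCMField.complexConj L • w.1 = w.1)
    [mG : MeasurableSpace (Gqs L v ⧸ Subgroup.center (Gqs L v))] [bG : BorelSpace (Gqs L v ⧸ Subgroup.center (Gqs L v))]
    (μZ : Measure (Gqs L v ⧸ Subgroup.center (Gqs L v))) [hμZ : μZ.IsHaarMeasure]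
    (r : SmoothIrrep (Gqs L v)) (hL2 : (IrrClass.mk r).IsSquareIntegrable μZ)
    {E : Type} [AddCommGroup E] [Module ℂ E] (ρE : Representation ℂ (Gqs L v) E) (hE : ρE.IsSmooth)
    (i : r.ρ.IntertwiningMap ρE) (p : ρE.IntertwiningMap r.ρ) (hi : Function.Injective i)
    (hker : LinearMap.ker p.toLinearMap = LinearMap.range i.toLinearMap) (hp : Function.Surjective p) :
    ρE.IsAdmissible ∧
      (∃ ω : ↥(Subgroup.center (Gqs L v)) →* ℂˣ,
        (∀ (z : ↥(Subgroup.center (Gqs L v))) (x : E), ρE (z : Gqs L v) x = ((ω z : ℂˣ) : ℂ) • x) ∧ ∀ z, ‖((ω z : ℂˣ) : ℂ)‖ = 1) ∧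
      ∀ (μZ' : Measure (Gqs L v ⧸ Subgroup.center (Gqs L v))) [μZ'.IsHaarMeasure], ρE.IsSquareIntegrableModCenter μZ' := by
  have hr : r.ρ.IsAdmissible := F0P3cStCharTSScTracePackage.isAdmissible_smoothIrrep L v hns r
  have hexact : Function.Exact i p := LinearMap.exact_iff.2 hker
  -- (1) admissibility of the middle term
  have hadm : ρE.IsAdmissible := Representation.IsAdmissible.of_exact hr hr hE i p hi hexact
  -- (2) the central character: `Z(G)` compact at a non-split place, `ω_r` unitary, propagated to `ρE`
  -- (`Gqs L v` is the carrier `↥(unitaryGroupOfForm …)` by `rfl`, not reducibly: the irreducibility instance is passed by hand)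
  obtain ⟨ω, hω, hω1⟩ := @F0P3bCentralCharacterUnitaryNonsplit.exists_centralChar_norm_eq_one_of_nonsplit L _ _ _ 3 v hns r.V _ _ r.ρ
    r.isIrreducible hr
  have hZ := F0P3bCentralCharacterUnitaryNonsplit.isCompact_center_cmLocal_of_nonsplit L 3 v hns
  have hωE : ∀ (z : ↥(Subgroup.center (Gqs L v))) (x : E), ρE (z : Gqs L v) x = ((ω z : ℂˣ) : ℂ) • x :=
    Representation.forall_apply_eq_smul_of_exact_of_isCompact_center hZ hE i p hexact ω hω hω
  refine ⟨hadm, ⟨ω, hωE, hω1⟩, fun μZ' hμZ' => ?_⟩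
  -- (3) Casselman's criterion, both ways (`Gqs L v`-typed instances are handed to ★ N5 positionally: `Gqs` unfolds to the carrier by `rfl`, not reducibly)
  haveI := locallyCompactSpace_cmBorelU L 3 v
  have hN := isLimitOfCompactOpen_cmBorelTriple_N L 3 v
  have N5 := (U3SquareIntegrableExponents_iff L).1 (F0P3U3SquareIntegrableExponentsHolds.u3SquareIntegrableExponents_holds L)
  -- the square-integrable representative `r'` of the class of `r`, its central character, and «⇒»
  obtain ⟨r', hr'r, hr'L2⟩ := hL2
  have hr' : r'.ρ.IsAdmissible := F0P3cStCharTSScTracePackage.isAdmissible_smoothIrrep L v hns r'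
  obtain ⟨ω', hω', hω'1⟩ := @F0P3bCentralCharacterUnitaryNonsplit.exists_centralChar_norm_eq_one_of_nonsplit L _ _ _ 3 v hns r'.V _ _ r'.ρ
    r'.isIrreducible hr'
  obtain ⟨e⟩ := (IrrClass.mk_eq_mk_iff r' r).1 hr'r
  have hbound := ((@N5 v hns mG bG μZ hμZ r'.V _ _ r'.ρ hr' ω' hω').1 ⟨hω'1, hr'L2⟩).2
  -- «⇐» at `ρE`
  refine ((@N5 v hns mG bG μZ' hμZ' E _ _ ρE hadm ω hωE).2 ⟨hω1, fun χ' hχ' a ha0 ha1 hlt => ?_⟩).2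
  -- an exponent of `ρE` is an exponent of `r` (sub or quotient), hence of `r' ≅ r`
  have hr_exp : r.ρ.HasJacquetExponent (cmBorelTriple L 3 v) χ' := by
    rcases Representation.hasJacquetExponent_of_shortExact (cmBorelTriple L 3 v) hN hE i p hi hexact hp hχ' with h | h
    · exact h
    · exact h
  have hsymm_inj : Function.Injective e.symm.toIntertwiningMap := fun a b hab => e.symm.injective hab
  have hr'_exp : r'.ρ.HasJacquetExponent (cmBorelTriple L 3 v) χ' :=
    hr_exp.map_of_injective (cmBorelTriple L 3 v) e.symm.toIntertwiningMap
      (Representation.jacquetMap_injective (cmBorelTriple L 3 v) hN r'.isSmooth e.symm.toIntertwiningMap hsymm_inj)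
  exact hbound χ' hr'_exp a ha0 ha1 hlt

end Summit.HodgeConjecture.HodgeConjecture.Cruxes.H413.F0P3cStCharTSSelfExtSquareIntegrable

end
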